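import Mathlib
import Summits.Ventures.PercRepro2.HCov
import Summits.Ventures.PercRepro2.HullDefs
import Summits.Ventures.PercRepro2.A3Fibre
import Summits.Ventures.PercRepro2.SwOutCoreShadowArm
import Summits.Ventures.PercRepro2.GcInterior
import Summits.Ventures.PercRepro2.GcInteriorPos

/-!
# Which fibres of the `a₃`-exploration are non-empty (blind cell PercRepro2, typer-1 g55)

The fibre `Q ∩ {C(a₃) = W}` (`A3Fibre.fibre`, `Q = {a₁ ↮ a₂}`) is non-empty exactly when `W`
is a FEASIBLE cluster: `a₃ ∈ W`, `W` is connected by the edges inside it, and `W` does not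
contain both roots. The witness is the configuration opening exactly the edges inside `W`
(night-4's `LocRows.withinConfig`), whose cluster of `a₃` is `W`; conversely a cluster is
connected inside itself (`LocRows.conn_withinConfig_of_mem_cluster`) and `Q` forbids both roots
in `C(a₃)`. At interior weights the fibre mass `m_W` is positive exactly on the feasible `W`
(`mW_pos_iff_of_int`, `GcInteriorA3.lean`), so:

* `cluster_withinConfig_subset`, `eq_of_conn_withinConfig_of_notMem` — the cluster structure of
  `withinConfig`: inside `W` it stays in `W`, outside `W` every vertex is isolated;
* `withinConfig_mem_fibre` — the witness lies in the fibre of a feasible `W`;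
* **`A3Fibre.fibre_nonempty_iff`** — feasibility characterises the non-empty fibres;
* **`A3Fibre.mW_pos_iff_feasible_of_int`** — at interior weights, `m_W > 0 ↔ W` feasible.
-/

namespace Summit.Ventures.PercRepro2

open CovForm UnionCluster LocRows Hull

/-! ## The cluster structure of `withinConfig` -/

section Within

variable {V : Type*} {E : Type*} [Fintype E] [DecidableEq E] {ends : E → Sym2 V}

omit [Fintype E] [DecidableEq E] in
/-- An open edge of `withinConfig W` at a vertex of `W` leads to a vertex of `W`. -/
lemma mem_of_adj_withinConfig {W : Set V} {x y : V}
    (hxy : (openGraph ends (withinConfig ends W)).Adj x y) : y ∈ W := by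
  obtain ⟨_, e, he, hends⟩ := openGraph_adj.1 hxy
  obtain ⟨x', hx', y', hy', hxy'⟩ := withinConfig_eq_true_iff.1 he
  rw [hends, Sym2.eq_iff] at hxy'
  rcases hxy' with ⟨_, h2⟩ | ⟨_, h2⟩
  · rw [h2]; exact hy'
  · rw [h2]; exact hx'

omit [Fintype E] [DecidableEq E] in
/-- Inside `W` the clusters of `withinConfig W` stay in `W`. -/
lemma cluster_withinConfig_subset {W : Set V} {x : V} (hx : x ∈ W) :
    cluster ends (withinConfig ends W) x ⊆ W := fun _ hv =>
  mem_of_conn_of_closed (S := W) (fun _ _ _ hab => mem_of_adj_withinConfig hab) hx hv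

omit [Fintype E] [DecidableEq E] in
/-- Outside `W` every vertex is isolated in `withinConfig W`. -/
lemma eq_of_conn_withinConfig_of_notMem {W : Set V} {x y : V} (hx : x ∉ W)
    (h : Conn ends (withinConfig ends W) x y) : y = x := by
  have hmem := mem_of_conn_of_closed (S := {x}) (fun z hz w hzw => ?_) (Set.mem_singleton x) h
  · exact Set.mem_singleton_iff.1 hmem
  · exfalso
    rw [Set.mem_singleton_iff] at hz
    subst hz
    obtain ⟨_, e, he, hends⟩ := openGraph_adj.1 hzw
    obtain ⟨x', hx', y', hy', hxy'⟩ := withinConfig_eq_true_iff.1 he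
    rw [hends, Sym2.eq_iff] at hxy'
    rcases hxy' with ⟨h1, _⟩ | ⟨h1, _⟩
    · exact hx (h1 ▸ hx')
    · exact hx (h1 ▸ hy')

end Within

/-! ## Feasible clusters -/

namespace CovForm.A3Fibre

section Feasible

variable {V : Type*} {E : Type*} [Fintype E] [DecidableEq E] {ends : E → Sym2 V}

omit [Fintype E] [DecidableEq E] in
/-- **The witness**: for `W` feasible (`a₃ ∈ W`, connected inside itself, not both roots) the
configuration opening exactly the edges inside `W` lies in the fibre of `W`. -/
lemma withinConfig_mem_fibre {a₁ a₂ a₃ : V} (h12 : a₁ ≠ a₂) {W : Finset V} (h3 : a₃ ∈ W)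
    (hconn : ∀ x ∈ W, Conn ends (withinConfig ends (↑W : Set V)) a₃ x)
    (hroots : ¬ (a₁ ∈ W ∧ a₂ ∈ W)) :
    withinConfig ends (↑W : Set V) ∈ fibre ends a₁ a₂ a₃ W := by
  refine ⟨?_, ?_⟩
  · -- `a₂ ↮ a₁`
    intro x hx hc
    rw [Finset.mem_singleton] at hx
    subst hx
    by_cases h2 : a₂ ∈ W
    · have h1 : x ∈ (↑W : Set V) := cluster_withinConfig_subset (by exact_mod_cast h2) hc
      exact hroots ⟨by exact_mod_cast h1, h2⟩
    · exact h12 (eq_of_conn_withinConfig_of_notMem (by exact_mod_cast h2) hc)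
  · -- `C(a₃) = W`
    rw [mem_clusterEvent]
    apply Set.Subset.antisymm
    · exact cluster_withinConfig_subset (by exact_mod_cast h3)
    · intro x hx
      exact hconn x (by exact_mod_cast hx)

omit [Fintype E] [DecidableEq E] in
/-- **The non-empty fibres are the feasible clusters**: `a₃ ∈ W`, `W` connected by the edges
inside it, and not both roots in `W`. -/
theorem fibre_nonempty_iff {a₁ a₂ a₃ : V} (h12 : a₁ ≠ a₂) (W : Finset V) :
    (fibre ends a₁ a₂ a₃ W).Nonempty ↔
      a₃ ∈ W ∧ (∀ x ∈ W, Conn ends (withinConfig ends (↑W : Set V)) a₃ x) ∧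
        ¬ (a₁ ∈ W ∧ a₂ ∈ W) := by
  constructor
  · rintro ⟨ω, hQ, hW⟩
    rw [mem_clusterEvent] at hW
    refine ⟨?_, fun x hx => ?_, fun h => ?_⟩
    · have := mem_cluster_self ends ω a₃
      rw [hW] at this
      exact_mod_cast this
    · have hx' : x ∈ cluster ends ω a₃ := by rw [hW]; exact_mod_cast hx
      have := conn_withinConfig_of_mem_cluster hx'
      rwa [hW] at this
    · have h1 : a₁ ∈ cluster ends ω a₃ := by rw [hW]; exact_mod_cast h.1
      have h2 : a₂ ∈ cluster ends ω a₃ := by rw [hW]; exact_mod_cast h.2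
      exact hQ a₁ (Finset.mem_singleton_self a₁) (conn_trans (conn_symm h2) h1)
  · rintro ⟨h3, hconn, hroots⟩
    exact ⟨_, withinConfig_mem_fibre h12 h3 hconn hroots⟩

variable {R : Type*} [Field R] [LinearOrder R] [IsStrictOrderedRing R]

/-- **At interior weights `m_W > 0` exactly on the feasible clusters.** -/
theorem mW_pos_iff_feasible_of_int {p : E → R} (hp : IsIntVec p) {a₁ a₂ a₃ : V} (h12 : a₁ ≠ a₂)
    (W : Finset V) :
    0 < mW p ends a₁ a₂ a₃ W ↔
      a₃ ∈ W ∧ (∀ x ∈ W, Conn ends (withinConfig ends (↑W : Set V)) a₃ x) ∧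
        ¬ (a₁ ∈ W ∧ a₂ ∈ W) :=
  (prob_pos_iff_of_int hp).trans (fibre_nonempty_iff h12 W)

end Feasible

end CovForm.A3Fibre

end Summit.Ventures.PercRepro2
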